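import Summits.CriticalPhenomena.PercolationContinuityZ3.Theorems.PercNearOneGluingNoHeavyPcintMemUniformPolyCert
import HarnessLib

/-!
# CriticalPhenomena/PercolationContinuityZ3 — Theorems/PercNearOneGluingNoHeavyPcintMemUniformPolyCount.lean: exact counts of the base-5 uniform automaton as POLYNOMIALS IN `d`, certified stage by stage in the kernel

Lane prim-pcint, STRUCTURE rule (prim-pcint-2 GEN 18).  The closing counts `2τ·p_τ(ℤ^d) = cntP (mstep τ) (age τ−1 present) ∅ (τ−1)`
(…ClosingCountKernel) are, for `d ≥ 5`, counts of the uniform index automaton of a dimension-5 row list (…PcintMemUniformGen,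
`cntP_mstep_eq_cntP_uistepK`), whose first-letter recursion is affine in `d` (…PcintMemUniformGenBounds, `cntP_uistepK_succ_real`).
Here the recursion is run on coefficient lists (…PcintPolyCert) in STAGES that the kernel checks one at a time on small literals
(association lists `row ↦ polynomial`, only the rows that matter): `LevelOK5 L d P k lit` says every entry of `lit` is the level-`k`
count polynomial of its row; **`levelOK5_init`** (`initOK5`, decidable) and **`levelOK5_step`** (`stageOK5 L prev next`, decidable:
every entry of `next` is recomputed from `prev`) propagate it, for every `d ≥ 5` at once.  Consumer: …ClosingOctagonsExactAll
(`2·8·p_8(ℤ^d) = 16·(7C(d,2) + 186C(d,3) + 648C(d,4))` for all `d ≥ 5`, seven stages).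

HONEST FRAMING: bookkeeping.  No `sorry`; standard axioms.  Written by prim-pcint-2 gen 18 (prover-prim-pcint-2-g18-0), 2026-08-26.
-/

noncomputable section

open Literature.Probability.Percolation Literature.Probability.LatticeModels

namespace Summit.CriticalPhenomena.PercolationContinuityZ3.Theorems.Pcint

open PolyCert

variable {d : ℕ}

/-- Association-list lookup (first match). [folklore] -/
def alookup (j : ℕ) : List (ℕ × List ℤ) → Option (List ℤ)
  | [] => none
  | q :: l => if q.1 = j then some q.2 else alookup j l

/-- A successful lookup is a member. [folklore] -/
theorem mem_of_alookup {j : ℕ} {p : List ℤ} : ∀ {l : List (ℕ × List ℤ)}, alookup j l = some p → (j, p) ∈ l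
  | [], h => by simp [alookup] at h
  | q :: l, h => by
    simp only [alookup] at h
    split_ifs at h with hq
    · simp only [Option.some.injEq] at h
      subst h
      rcases q with ⟨q1, q2⟩
      simp only at hq
      subst hq
      exact List.mem_cons_self
    · exact List.mem_cons_of_mem _ (mem_of_alookup h)

/-- Recompute the level-`k+1` polynomial of row `i` from an association list of level-`k` polynomials (all successors must be
present). [folklore] -/
def combine5 (L : List (SCertRow 5)) (prev : List (ℕ × List ℤ)) (i : ℕ) : Option (List ℤ) :=
  if ((baseIdx5 L i).reduceOption ++ (freshIdx5 L i).reduceOption).all (fun j => (alookup j prev).isSome) then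
    some (padd (psum (((baseIdx5 L i).reduceOption).map fun j => (alookup j prev).getD []))
      (pmul [-5, 1] (psum (((freshIdx5 L i).reduceOption).map fun j => (alookup j prev).getD []))))
  else none

/-- Stage check: every entry of `next` is recomputed from `prev`. Decidable (a `Bool`). [folklore] -/
def stageOK5 (L : List (SCertRow 5)) (prev next : List (ℕ × List ℤ)) : Bool :=
  next.all fun q => decide (combine5 L prev q.1 = some q.2)

/-- Initial check: every entry of `lit` is the level-0 value `[1]` / `[]` of its row. [folklore] -/
def initOK5 (P : ℕ → Prop) [DecidablePred P] (lit : List (ℕ × List ℤ)) : Bool :=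
  lit.all fun q => decide (q.2 = if P q.1 then [1] else [])

/-- Correctness of a level-`k` association list at dimension `d`. [folklore] -/
def LevelOK5 (L : List (SCertRow 5)) (d : ℕ) (P : ℕ → Prop) [DecidablePred P] (k : ℕ) (lit : List (ℕ × List ℤ)) : Prop :=
  ∀ q ∈ lit, peval q.2 d = (cntP (uistepK 4 L d) P q.1 k : ℝ)

/-- The initial list is correct. [folklore] -/
theorem levelOK5_init (L : List (SCertRow 5)) (P : ℕ → Prop) [DecidablePred P] {lit : List (ℕ × List ℤ)}
    (h : initOK5 P lit = true) : LevelOK5 L d P 0 lit := by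
  intro q hq
  have hq' := List.all_eq_true.1 h q hq
  simp only [decide_eq_true_eq] at hq'
  rw [hq']
  simp only [cntP]
  by_cases hP : P q.1 <;> simp [hP, peval]

/-- **Stage propagation**: a correct level-`k` list and a passing stage check give a correct level-`k+1` list (`d ≥ 5`). [folklore] -/
theorem levelOK5_step {L : List (SCertRow 5)} (hd : 5 ≤ d) {P : ℕ → Prop} [DecidablePred P] {k : ℕ}
    {prev next : List (ℕ × List ℤ)} (hprev : LevelOK5 L d P k prev) (h : stageOK5 L prev next = true) :
    LevelOK5 L d P (k + 1) next := by
  intro q hq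
  have hq' := List.all_eq_true.1 h q hq
  simp only [decide_eq_true_eq, combine5] at hq'
  split_ifs at hq' with hall
  simp only [Option.some.injEq] at hq'
  rw [← hq', peval_padd, peval_pmul, peval_psum, peval_psum, List.map_map, List.map_map]
  have h5 : peval [-5, 1] (d : ℝ) = (d : ℝ) - (4 + 1) := by simp [peval]; ring
  rw [h5, cntP_uistepK_succ_real L hd P q.1 k, baseSum5_eq, freshSum5_eq, sum_map_optValR_eq, sum_map_optValR_eq]
  have hval : ∀ j ∈ (baseIdx5 L q.1).reduceOption ++ (freshIdx5 L q.1).reduceOption,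
      peval ((alookup j prev).getD []) d = (cntP (uistepK 4 L d) P j k : ℝ) := by
    intro j hj
    have hs := List.all_eq_true.1 hall j hj
    cases hlk : alookup j prev with
    | none => rw [hlk] at hs; simp at hs
    | some p =>
      simp only [Option.getD_some]
      exact hprev (j, p) (mem_of_alookup hlk)
  congr 1
  · congr 1
    exact List.map_congr_left fun j hj => hval j (List.mem_append_left _ hj)
  · congr 1
    congr 1
    exact List.map_congr_left fun j hj => hval j (List.mem_append_right _ hj)

end Summit.CriticalPhenomena.PercolationContinuityZ3.Theorems.Pcint
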